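import Mathlib.GroupTheory.Index
import Literature.NumberTheory.Automorphic.FixedPointsQuotientFibration   -- ★ B-p04 p842457: `natCard_fixedBy_quotient_eq_sum_of_le`, `inv_mul_mul_mem_of_smul_eq`
import HarnessLib

/-!
# Fixed points along `G ⧸ K′ → G ⧸ K` for a level `K′` NORMAL in `K`: `#Fix_γ(G ⧸ K′) = [K : K′] · #{x ∈ Fix_γ(G ⧸ K) : γ_x ∈ K′}`
(Kottwitz 1988 §2; Serre, *Trees*, I §6 — the congruence-level lowering of fixed-point counts on a Bruhat–Tits tree)

Topic `NumberTheory/Automorphic`; namespace `Literature.NumberTheory.Automorphic`.  THEOREMS ONLY (no definition, no instance, no notation, no named fact, no `sorry`); pure group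
theory over ★ `FixedPointsQuotientFibration` (B-p04 (g34), p842457).  Cell `pub/hodgecm-mathlib` (D-0151), crux H413 = `stmt-HodgeConjecture-24833`; road «R1LL-tree» (LEAD F0P3a-plan
(g10) WORD T9-8 (A); architect A-p16 (g27); in-house pay-down of the (R1-CM) letter `RankOneUnstableTransferNonsplitCM` of line «N6nsGerm»), brick (G2) «level-`K_j` ball counts»,
FIRST (design-independent) piece: the LEVEL-LOWERING lemma; seat A-p13 (g31).  HONEST LABEL: HC_CM is proved only modulo the 2 remaining named inputs (hLiu418, h413) until
rung 0 closes; nothing printed is asserted here.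

THE MATHEMATICS.  `K′ ≤ K ≤ G` with `K′` normal IN `K` (e.g. a principal congruence subgroup `K_j` of a hyperspecial `K`), `γ ∈ G`, `r` a section of `G → G ⧸ K`.  ★ p842457 writes
`#Fix_γ(G ⧸ K′) = Σ_{x ∈ Fix_γ(G ⧸ K)} #Fix_{γ_x}(K ⧸ K′_K)` with the local monodromy `γ_x = r(x)⁻¹ γ r(x) ∈ K`.  For `K′ ⊲ K` the fibre is ALL OR NOTHING: an element `k ∈ K`
fixes EVERY coset of `K ⧸ K′` if `k ∈ K′` (`k·k₁K′ = k₁·(k₁⁻¹kk₁)K′ = k₁K′`) and NO coset otherwise (`k·k₁K′ = k₁K′ ⇒ k ∈ k₁K′k₁⁻¹ = K′`) (§1); the condition `γ_x ∈ K′` does not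
depend on the representative of `x` (§1); hence **`#Fix_γ(G ⧸ K′) = [K : K′] · #{x ∈ Fix_γ(G ⧸ K) : γ_x ∈ K′}`** (§2) — on the tree of `U(Φ₂)_v`: the level-`j` fixed cosets over
the `γ`-fixed vertices `x` at which `γ` acts trivially modulo `𝔪^j`, each with multiplicity `[K : K_j]`.

References: [Kottwitz1988] R. E. Kottwitz, *Tamagawa numbers*, Ann. of Math. 127 (1988), §2 · [Serre1980Trees] J.-P. Serre, *Trees* (1980), I §6.
-/

set_option autoImplicit false

namespace Literature.NumberTheory.Automorphic

open MulAction

section NormalLevel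

variable {G : Type*} [Group G] {I K : Subgroup G} (hIK : I ≤ K) (hN : (I.subgroupOf K).Normal)
  (r : G ⧸ K → G) (hr : Function.RightInverse r QuotientGroup.mk) (γ : G)

/-! ## §1 The fibre of a normal level is all or nothing; the condition is representative-free -/

include hN in
/-- An element of the level `K′ ⊲ K` fixes EVERY coset of `K ⧸ K′`. [cite: Serre1980Trees, I §6] -/
theorem fixedBy_quotient_subgroupOf_eq_univ_of_mem (k : K) (hk : (k : G) ∈ I) :
    fixedBy (K ⧸ I.subgroupOf K) k = Set.univ := by
  ext y
  simp only [MulAction.mem_fixedBy, Set.mem_univ, iff_true]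
  induction y using QuotientGroup.induction_on with
  | H k₁ =>
    rw [MulAction.Quotient.smul_mk, QuotientGroup.eq]
    show (k * k₁)⁻¹ * k₁ ∈ I.subgroupOf K
    have h : k₁⁻¹ * k⁻¹ * k₁⁻¹⁻¹ ∈ I.subgroupOf K := hN.conj_mem _ (Subgroup.mem_subgroupOf.2 (I.inv_mem hk)) k₁⁻¹
    rwa [inv_inv, ← mul_inv_rev] at h

include hN in
/-- An element of `K` outside the level `K′ ⊲ K` fixes NO coset of `K ⧸ K′`. [cite: Serre1980Trees, I §6] -/
theorem fixedBy_quotient_subgroupOf_eq_empty_of_not_mem (k : K) (hk : (k : G) ∉ I) :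
    fixedBy (K ⧸ I.subgroupOf K) k = ∅ := by
  ext y
  simp only [MulAction.mem_fixedBy, Set.mem_empty_iff_false, iff_false]
  induction y using QuotientGroup.induction_on with
  | H k₁ =>
    rw [MulAction.Quotient.smul_mk, QuotientGroup.eq]
    intro h
    apply hk
    -- `(k k₁)⁻¹ k₁ ∈ K′` ⇒ `k⁻¹ = k₁ ((k k₁)⁻¹ k₁) k₁⁻¹ ∈ K′` ⇒ `k ∈ K′`
    have h' : k₁ * ((k • k₁)⁻¹ * k₁) * k₁⁻¹ ∈ I.subgroupOf K := hN.conj_mem _ h k₁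
    have hk' : k⁻¹ ∈ I.subgroupOf K := by
      have e : k₁ * ((k • k₁)⁻¹ * k₁) * k₁⁻¹ = k⁻¹ := by rw [smul_eq_mul]; group
      rwa [e] at h'
    simpa using Subgroup.mem_subgroupOf.1 ((I.subgroupOf K).inv_mem hk')

include hN in
/-- **ALL OR NOTHING**: `#Fix_k(K ⧸ K′) = [K : K′]` if `k ∈ K′`, `0` otherwise (`K′ ⊲ K`, finite index). [cite: Kottwitz1988, §2] [cite: Serre1980Trees, I §6] -/
theorem natCard_fixedBy_quotient_subgroupOf_eq_ite (k : K) [Decidable ((k : G) ∈ I)] :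
    Nat.card (fixedBy (K ⧸ I.subgroupOf K) k) = if (k : G) ∈ I then I.relIndex K else 0 := by
  split_ifs with hk
  · rw [fixedBy_quotient_subgroupOf_eq_univ_of_mem hN k hk, Nat.card_congr (Equiv.Set.univ _)]
    rfl
  · rw [fixedBy_quotient_subgroupOf_eq_empty_of_not_mem hN k hk]
    simp

include hIK hN in
/-- **The level condition is REPRESENTATIVE-FREE**: for `gK = g′K`, `g⁻¹ γ g ∈ K′ ↔ g′⁻¹ γ g′ ∈ K′` (`g′ = g k`, `K′ ⊲ K`). [cite: Serre1980Trees, I §6] -/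
theorem inv_mul_mul_mem_iff_of_mk_eq {g g' : G} (h : (QuotientGroup.mk g : G ⧸ K) = QuotientGroup.mk g') :
    g⁻¹ * γ * g ∈ I ↔ g'⁻¹ * γ * g' ∈ I := by
  obtain ⟨k, hk, rfl⟩ : ∃ k ∈ K, g' = g * k := ⟨g⁻¹ * g', QuotientGroup.eq.1 h, by group⟩
  have key : ∀ {x : G}, x ∈ I → (⟨k, hk⟩ : K)⁻¹ * x * (⟨k, hk⟩ : K) ∈ I := fun {x} hx => by
    have h1 : (⟨k, hk⟩ : K)⁻¹ * ⟨x, hIK hx⟩ * (⟨k, hk⟩ : K)⁻¹⁻¹ ∈ I.subgroupOf K := hN.conj_mem _ (Subgroup.mem_subgroupOf.2 hx) _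
    simpa using Subgroup.mem_subgroupOf.1 h1
  constructor
  · intro hx
    have := key hx
    simpa [mul_assoc] using this
  · intro hx
    have hkK : k⁻¹ ∈ K := K.inv_mem hk
    have h1 : (⟨k⁻¹, hkK⟩ : K)⁻¹ * ⟨(g * k)⁻¹ * γ * (g * k), hIK hx⟩ * (⟨k⁻¹, hkK⟩ : K)⁻¹⁻¹ ∈ I.subgroupOf K :=
      hN.conj_mem _ (Subgroup.mem_subgroupOf.2 hx) _
    have h2 := Subgroup.mem_subgroupOf.1 h1
    simp only [inv_inv, Subgroup.coe_mul, Subgroup.coe_inv, mul_inv_rev] at h2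
    have e : k * (k⁻¹ * g⁻¹ * γ * (g * k)) * k⁻¹ = g⁻¹ * γ * g := by group
    rwa [e] at h2

/-! ## §2 The level-lowering formula -/

include hIK hN hr in
/-- **`#Fix_γ(G ⧸ K′) = [K : K′] · #{x ∈ Fix_γ(G ⧸ K) : γ_x ∈ K′}`** for a level `K′ ⊲ K` of finite index, `γ_x = r(x)⁻¹ γ r(x)` (any section `r`; the condition is
representative-free by `inv_mul_mul_mem_iff_of_mk_eq`), when `Fix_γ(G ⧸ K)` is finite — ★ `natCard_fixedBy_quotient_eq_sum_of_le` with the all-or-nothing fibres of §1.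
On the tree of `U(Φ₂)_v` with `K` a vertex stabiliser and `K′ = K_j` its `j`-th congruence subgroup: the level-`j` count is `[K : K_j]` times the number of `γ`-fixed vertices of
type `K` at which `γ ≡ 1 (mod 𝔪^j)`. [cite: Kottwitz1988, §2 Theorem 2] [cite: Serre1980Trees, I §6] -/
theorem natCard_fixedBy_quotient_eq_relindex_mul_natCard [Fintype (fixedBy (G ⧸ K) γ)] [Finite (K ⧸ I.subgroupOf K)] :
    Nat.card (fixedBy (G ⧸ I) γ) = I.relIndex K * Nat.card {x : fixedBy (G ⧸ K) γ // (r x.1)⁻¹ * γ * r x.1 ∈ I} := by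
  classical
  haveI : ∀ x : fixedBy (G ⧸ K) γ, Finite (fixedBy (K ⧸ I.subgroupOf K) (⟨(r x.1)⁻¹ * γ * r x.1, inv_mul_mul_mem_of_smul_eq r hr γ x.2⟩ : K)) :=
    fun x => inferInstance
  rw [natCard_fixedBy_quotient_eq_sum_of_le hIK r hr γ]
  have hterm : ∀ x : fixedBy (G ⧸ K) γ,
      Nat.card (fixedBy (K ⧸ I.subgroupOf K) (⟨(r x.1)⁻¹ * γ * r x.1, inv_mul_mul_mem_of_smul_eq r hr γ x.2⟩ : K)) =
        if (r x.1)⁻¹ * γ * r x.1 ∈ I then I.relIndex K else 0 := fun x =>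
    natCard_fixedBy_quotient_subgroupOf_eq_ite hN _
  simp_rw [hterm]
  rw [Finset.sum_ite, Finset.sum_const_zero, add_zero, Finset.sum_const, smul_eq_mul, mul_comm, Nat.card_eq_fintype_card, Fintype.card_subtype]

end NormalLevel

end Literature.NumberTheory.Automorphic
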